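import Literature.AlgebraicGeometry.HodgeTheory.ProjectiveSpaceBottFormulaGlobalSections
import Literature.AlgebraicGeometry.HodgeTheory.GAGADifferentialFormsCohomology
import Literature.Algebra.Homology.LaurentCechFreeTopCohomology
import HarnessLib

/-!
# Bott's formula, row `q = n`: `h^r(ℙ_r, Ω^p(k)) = C(-k+p, -k)·C(-k-1, r-p)` (`k < p - r`)

Okonek–Schneider–Spindler, *Vector bundles on complex projective spaces*, Ch. I § 1.1 (p. 8),
BOTT FORMULA, third case: "`h^q(ℙ_n, Ω^p_{ℙ_n}(k)) = C(-k+p, -k)·C(-k-1, n-p)` for `q = n`,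
`0 ≤ p ≤ n`, `k < p - n`", "`1` for `k = 0`, `0 ≤ p = q ≤ n`", "`0` otherwise" — by Serre
duality `h^q(ℙ_n, Ω^p(k)) = h^{n-q}(ℙ_n, Ω^{n-p}(-k))` these are the numbers of the row `q = 0`
(`ProjectiveSpaceBottFormulaGlobalSections`) read backwards. This file proves the row `q = n`
DIRECTLY (no duality) in the tree's Čech language for `ℙ_r`, `r ≥ 1`, on both sides of GAGA, by
the same dévissage as the row `q = 0`: the long exact cohomology sequences of the exterior powers
(3) `0 → Z_{p+1} → Λ^{p+1}P^{r+1}(-p-1) → Z_p → 0` of the Euler sequence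
(`KoszulCech.Datum.ses` of the algebraic datum `GAGAForms.algDatum r k`) END at
`H^r(Λ^{p+1}(k)) → H^r(Z_p(k)) → 0` (`H^{r+1} = 0` on `ℙ_r`), and the map
`H^r(Z_{p+1}(k)) → H^r(Λ^{p+1}(k))` is injective as soon as `H^{r-1}(Z_p(k)) = 0`, which holds off
`(p, k) = (r-1, 0)` by the middle-range vanishing of `ProjectiveSpaceBottVanishing`; the ranks of
the free terms `H^r(Č_k(Λ^{p+1}P^{r+1}(-p-1))) = C(r+1, p+1)·C(p-k, r)` are the negative-monomial
counts of `LaurentCechFreeTopCohomology` (Görtz–Wedhorn II Thm. 22.22 (3)).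

* `GAGAForms.finrank_homology_freeCx_top` — `dim H^r(ℙ_r, Λ^{p+1}𝒪^{r+1}(k-p-1)) = C(r+1,p+1)·C(p-k, r)`;
* `GAGAForms.finrank_homology_cech_Zsub_top_add_of_mono`, `…_top_le` — the top end of the long exact
  sequence as a dimension count: `dim H^r(Z_p(k)) + dim H^r(Z_{p+1}(k)) = C(r+1,p+1)·C(p-k, r)`
  when `H^r(Z_{p+1}(k)) → H^r(Λ^{p+1}(k))` is injective (`mono_homologyMap_ses_f_of_isZero`: it is,
  when `H^{r-1}(Z_p(k)) = 0` or `H^r(Z_{p+1}(k)) = 0`), and `≤` always;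
* **`GAGAForms.finrank_homology_cech_Zsub_top`** — BOTT'S FORMULA, ROW `q = r`: for `r ≥ 1`,
  `0 ≤ p ≤ r` and every `k' ≥ 1`,
  **`dim_ℂ H^r(ℙ_r, Ω^p(-k')) = dim_ℂ H^r(Č_{-k'}(Z_p)) = C(k'+p, k')·C(k'-1, r-p)`** (OSS's
  `C(-k+p, -k)·C(-k-1, n-p)` with `k = -k'`; for `-k' ≥ p - r` the right-hand side is `0`, as printed
  under "otherwise"); `finrank_homology_cech_Zsub_top_of_nonneg` — `= 0` for `k ≥ 0`,
  `(p, k) ≠ (r, 0)`; `finrank_homology_cech_Zsub_top_of_lt` — `= 0` for `p > r`; and the complete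
  row as one statement `finrank_homology_cech_Zsub_top_eq` (with `h^{r,r} = 1` from
  `ProjectiveSpaceHodgeNumbers`);
* **`GAGAForms.finrank_homology_holCech_top`**, `finrank_homology_holCech_top_eq` — the same numbers
  for the holomorphic Čech cohomology `Ȟ^r(𝔘^h, Ω^p(k)^h)` of `ℙ_r(ℂ)` by Serre's GAGA isomorphisms.

Theorems only; no definitions, no named facts. The numerical identity of the induction step is
the one of the row `q = 0` (Serre duality at the level of Bott's numbers:
`h^r(Ω^p(-k')) = h⁰(Ω^{r-p}(k'))`), re-proved here as a private lemma.

## References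
* [OkonekSchneiderSpindler1980] C. Okonek, M. Schneider, H. Spindler, *Vector bundles on complex
  projective spaces* (1980), Ch. I § 1.1, Bott formula, case `q = n` (p. 8), and (3).
* [GortzWedhorn2023] U. Görtz, T. Wedhorn, *Algebraic Geometry II* (2023), Thm. 22.22 (3).
* [Weibel1994] C. A. Weibel, *An Introduction to Homological Algebra* (1994), Thm. 1.3.1 (long
  exact sequence).
* [SerreGAGA1956] J.-P. Serre, *GAGA*, Ann. Inst. Fourier 6 (1956), n° 12 Théorème 1.
-/

noncomputable section

open CategoryTheory CategoryTheory.Limits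

universe u

namespace Literature.AlgebraicGeometry.HodgeTheory

namespace GAGAForms

open Literature.Algebra.Homology Literature.Algebra.Homology.LaurentCech
  Literature.Algebra.Homology.KoszulCech Literature.Algebra.Homology.OrderedCech

variable {r : ℕ}

/-! ### The top end of a long exact cohomology sequence, as a dimension count -/

/-- For a short exact sequence of cochain complexes of `ℂ`-modules with `H^j(X₁) = 0`, `j = i + 1`
(so `H^i(X₂) → H^i(X₃)` is onto), `dim H^i(X₃) ≤ dim H^i(X₂)`. [cite: Weibel1994, Thm. 1.3.1] -/
private theorem finrank_homology_X₃_le {S : ShortComplex (CochainComplex (ModuleCat.{u} ℂ) ℤ)}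
    (hS : S.ShortExact) (i j : ℤ) (hij : i + 1 = j) (h1 : IsZero (S.X₁.homology j))
    [Module.Finite ℂ (S.X₂.homology i)] :
    Module.finrank ℂ (S.X₃.homology i) ≤ Module.finrank ℂ (S.X₂.homology i) := by
  have hepi : Epi (HomologicalComplex.homologyMap S.g i) :=
    (hS.homology_exact₃ i j hij).epi_f (h1.eq_of_tgt _ _)
  have hsurj : Function.Surjective (HomologicalComplex.homologyMap S.g i).hom :=
    (ModuleCat.epi_iff_surjective _).1 hepi
  have h := LinearMap.finrank_range_le (HomologicalComplex.homologyMap S.g i).hom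
  rwa [LinearMap.range_eq_top.2 hsurj, finrank_top] at h

/-- For a short exact sequence of cochain complexes of `ℂ`-modules with `H^j(X₁) = 0`, `j = i + 1`,
and `H^i(X₁) → H^i(X₂)` injective: `dim H^i(X₃) + dim H^i(X₁) = dim H^i(X₂)` (exactness at
`H^i(X₂)` and `H^i(X₃)`, rank–nullity). [cite: Weibel1994, Thm. 1.3.1] -/
private theorem finrank_homology_X₃_add {S : ShortComplex (CochainComplex (ModuleCat.{u} ℂ) ℤ)}
    (hS : S.ShortExact) (i j : ℤ) (hij : i + 1 = j) (h1 : IsZero (S.X₁.homology j))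
    (hmono : Mono (HomologicalComplex.homologyMap S.f i)) [Module.Finite ℂ (S.X₂.homology i)] :
    Module.finrank ℂ (S.X₃.homology i) + Module.finrank ℂ (S.X₁.homology i) =
      Module.finrank ℂ (S.X₂.homology i) := by
  have hepi : Epi (HomologicalComplex.homologyMap S.g i) :=
    (hS.homology_exact₃ i j hij).epi_f (h1.eq_of_tgt _ _)
  have hsurj : Function.Surjective (HomologicalComplex.homologyMap S.g i).hom :=
    (ModuleCat.epi_iff_surjective _).1 hepi
  have hinj : Function.Injective (HomologicalComplex.homologyMap S.f i).hom :=
    (ModuleCat.mono_iff_injective _).1 hmono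
  have hex : LinearMap.range (HomologicalComplex.homologyMap S.f i).hom =
      LinearMap.ker (HomologicalComplex.homologyMap S.g i).hom :=
    (hS.homology_exact₂ i).moduleCat_range_eq_ker
  have h := (HomologicalComplex.homologyMap S.g i).hom.finrank_range_add_finrank_ker
  rw [LinearMap.range_eq_top.2 hsurj, finrank_top, ← hex, LinearMap.finrank_range_of_inj hinj] at h
  exact h

/-- `H^i(X₁) → H^i(X₂)` is injective when `H^{i'}(X₃) = 0`, `i' + 1 = i` (the connecting map into
`H^i(X₁)` vanishes). [cite: Weibel1994, Thm. 1.3.1] -/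
private theorem mono_homologyMap_f_of_isZero {S : ShortComplex (CochainComplex (ModuleCat.{u} ℂ) ℤ)}
    (hS : S.ShortExact) (i' i : ℤ) (hi : i' + 1 = i) (h3 : IsZero (S.X₃.homology i')) :
    Mono (HomologicalComplex.homologyMap S.f i) :=
  (hS.homology_exact₁ i' i hi).mono_g (h3.eq_of_src _ _)

/-! ### The free terms: `dim H^r(ℙ_r, Λ^{p+1}𝒪^{r+1}(k-p-1)) = C(r+1, p+1)·C(p-k, r)` -/

/-- The homology of the free middle complex of the algebraic datum is finite-dimensional in
positive degrees. [cite: GortzWedhorn2023, Thm. 22.22 (3)] -/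
private theorem moduleFinite_homology_freeCx (k : ℤ) (q : ℕ) {i : ℤ} (hi : 1 ≤ i) :
    Module.Finite ℂ (((algDatum r k).freeCx q).homology i) :=
  LaurentCech.moduleFinite_homology_cech_top (fun _ : Sub (Fin (r + 1)) q => (q : ℤ)) k i hi

/-- **`dim_ℂ H^r(Č_k(Λ^{q}P^{r+1}(-q))) = C(r+1, q)·C(q-1-k, r)`**: the top cohomology of the free
sheaf `Λ^q 𝒪^{r+1}(k-q)` of rank `C(r+1, q)` on `ℙ_r`, `r ≥ 1`, counted by negative monomials
(`LaurentCech.finrank_homology_cech_top_top`; Görtz–Wedhorn II Thm. 22.22 (3):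
`h^r(𝒪(n)) = C(-n-1, r)` with `n = k - q`). [cite: GortzWedhorn2023, Thm. 22.22 (3)] -/
theorem finrank_homology_freeCx_top (hr : 1 ≤ r) (k : ℤ) (q : ℕ) :
    Module.finrank ℂ (((algDatum r k).freeCx q).homology r) =
      (r + 1).choose q * (((q : ℤ) - 1 - k).toNat).choose r := by
  change Module.finrank ℂ ((LaurentCech.cech (fun _ : Sub (Fin (r + 1)) q => (q : ℤ))
    (⊤ : Submodule (P ℂ r) _) k).homology r) = _
  rw [LaurentCech.finrank_homology_cech_top_top _ k hr]
  simp only [Finset.sum_const, Finset.card_univ, smul_eq_mul, Fintype.card_finset_len,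
    Fintype.card_fin]
  exact congrArg₂ (· * ·) rfl (congrArg₂ Nat.choose (by omega) rfl)

/-! ### The exact sequences (3) at the top degree -/

/-- **`dim H^r(Z_p(k)) ≤ C(r+1, p+1)·C(p-k, r)`** (`r ≥ 1`): `H^r(Λ^{p+1}(k)) → H^r(Z_p(k))` is onto,
`H^{r+1}` vanishing on `ℙ_r`. [cite: OkonekSchneiderSpindler1980, Ch. I § 1.1 (3) and Bott formula (p. 8)] -/
theorem finrank_homology_cech_Zsub_top_le (hr : 1 ≤ r) (p : ℕ) (k : ℤ) :
    Module.finrank ℂ ((LaurentCech.cech (fun _ : Sub (Fin (r + 1)) p => (p : ℤ)) (Zsub r p)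
      k).homology r) ≤ (r + 1).choose (p + 1) * (((p : ℤ) - k).toNat).choose r := by
  haveI : Module.Finite ℂ (((algDatum r k).ses p).X₂.homology (r : ℤ)) :=
    moduleFinite_homology_freeCx (r := r) k (p + 1) (i := r) (by exact_mod_cast hr)
  have h := finrank_homology_X₃_le ((algDatum r k).shortExact_ses uL_mul_xL p) r (r + 1) rfl
    (isZero_homology_cech_of_lt _ (Zsub r (p + 1)) k (r + 1) (by omega))
  have h2 : Module.finrank ℂ (((algDatum r k).ses p).X₂.homology (r : ℤ)) =
      (r + 1).choose (p + 1) * (((p : ℤ) - k).toNat).choose r := by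
    rw [show Module.finrank ℂ (((algDatum r k).ses p).X₂.homology (r : ℤ)) =
      Module.finrank ℂ (((algDatum r k).freeCx (p + 1)).homology (r : ℤ)) from rfl,
      finrank_homology_freeCx_top hr k (p + 1)]
    exact congrArg₂ (· * ·) rfl (congrArg₂ Nat.choose (by omega) rfl)
  rw [h2] at h
  exact h

/-- **`H^r(Z_{p+1}(k)) → H^r(Λ^{p+1}(k))` is injective when `H^{r-1}(Z_p(k)) = 0` or
`H^r(Z_{p+1}(k)) = 0`.** [cite: Weibel1994, Thm. 1.3.1] -/
theorem mono_homologyMap_ses_f_of_isZero (p : ℕ) (k : ℤ)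
    (h : IsZero ((LaurentCech.cech (fun _ : Sub (Fin (r + 1)) p => (p : ℤ)) (Zsub r p)
        k).homology ((r : ℤ) - 1)) ∨
      IsZero ((LaurentCech.cech (fun _ : Sub (Fin (r + 1)) (p + 1) => ((p + 1 : ℕ) : ℤ))
        (Zsub r (p + 1)) k).homology r)) :
    Mono (HomologicalComplex.homologyMap ((algDatum r k).ses p).f r) := by
  rcases h with h | h
  · exact mono_homologyMap_f_of_isZero ((algDatum r k).shortExact_ses uL_mul_xL p) (r - 1) r
      (by omega) h
  · exact mono_of_source_iso_zero _ h.isoZero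

/-- **`dim H^r(Z_p(k)) + dim H^r(Z_{p+1}(k)) = C(r+1, p+1)·C(p-k, r)` when
`H^r(Z_{p+1}(k)) → H^r(Λ^{p+1}(k))` is injective** (`r ≥ 1`): the top end
`H^r(Z_{p+1}) ↪ H^r(Λ^{p+1}) ↠ H^r(Z_p) → 0` of the long exact sequence of (3).
[cite: OkonekSchneiderSpindler1980, Ch. I § 1.1 (3) and Bott formula (p. 8)] [cite: Weibel1994, Thm. 1.3.1] -/
theorem finrank_homology_cech_Zsub_top_add_of_mono (hr : 1 ≤ r) (p : ℕ) (k : ℤ)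
    (hmono : Mono (HomologicalComplex.homologyMap ((algDatum r k).ses p).f r)) :
    Module.finrank ℂ ((LaurentCech.cech (fun _ : Sub (Fin (r + 1)) p => (p : ℤ)) (Zsub r p)
        k).homology r) +
      Module.finrank ℂ ((LaurentCech.cech (fun _ : Sub (Fin (r + 1)) (p + 1) => ((p + 1 : ℕ) : ℤ))
        (Zsub r (p + 1)) k).homology r) =
      (r + 1).choose (p + 1) * (((p : ℤ) - k).toNat).choose r := by
  haveI : Module.Finite ℂ (((algDatum r k).ses p).X₂.homology (r : ℤ)) :=
    moduleFinite_homology_freeCx (r := r) k (p + 1) (i := r) (by exact_mod_cast hr)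
  have h := finrank_homology_X₃_add ((algDatum r k).shortExact_ses uL_mul_xL p) r (r + 1) rfl
    (isZero_homology_cech_of_lt _ (Zsub r (p + 1)) k (r + 1) (by omega)) hmono
  have h2 : Module.finrank ℂ (((algDatum r k).ses p).X₂.homology (r : ℤ)) =
      (r + 1).choose (p + 1) * (((p : ℤ) - k).toNat).choose r := by
    rw [show Module.finrank ℂ (((algDatum r k).ses p).X₂.homology (r : ℤ)) =
      Module.finrank ℂ (((algDatum r k).freeCx (p + 1)).homology (r : ℤ)) from rfl,
      finrank_homology_freeCx_top hr k (p + 1)]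
    exact congrArg₂ (· * ·) rfl (congrArg₂ Nat.choose (by omega) rfl)
  rw [h2] at h
  exact h

/-! ### The binomial identity of the induction step -/

/-- The two hook numbers over a free term (as in `ProjectiveSpaceBottFormulaGlobalSections`):
`C(p+a+b+1, p+b+1)·C(p+b, p) + C(p+a+b, p+b+1)·C(p+b, p+1) = C(p+a+1, p+1)·C(p+a+b, p+a)`.
[folklore] -/
private theorem choose_mul_choose_add_choose_mul_choose (p a b : ℕ) :
    (p + a + b + 1).choose (p + b + 1) * (p + b).choose p +
        (p + a + b).choose (p + b + 1) * (p + b).choose (p + 1) =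
      (p + a + 1).choose (p + 1) * (p + a + b).choose (p + a) := by
  rcases Nat.eq_zero_or_pos a with rfl | ha
  · simp [Nat.choose_succ_self]
  rcases Nat.eq_zero_or_pos b with rfl | hb
  · simp [Nat.choose_succ_self]
  obtain ⟨a, rfl⟩ : ∃ a', a = a' + 1 := ⟨a - 1, by omega⟩
  obtain ⟨b, rfl⟩ : ∃ b', b = b' + 1 := ⟨b - 1, by omega⟩
  rw [show (p + (a + 1) + (b + 1) + 1).choose (p + (b + 1) + 1) =
      ((p + b + 2) + (a + 1)).choose (p + b + 2) from congrArg₂ Nat.choose (by omega) (by omega),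
    show (p + (a + 1) + (b + 1)).choose (p + (b + 1) + 1) = ((p + b + 2) + a).choose (p + b + 2) from
      congrArg₂ Nat.choose (by omega) (by omega),
    show (p + (b + 1)).choose (p + 1) = ((p + 1) + b).choose (p + 1) from
      congrArg₂ Nat.choose (by omega) rfl,
    show (p + (a + 1) + 1).choose (p + 1) = ((p + 1) + (a + 1)).choose (p + 1) from
      congrArg₂ Nat.choose (by omega) rfl,
    show (p + (a + 1) + (b + 1)).choose (p + (a + 1)) = ((p + a + 1) + (b + 1)).choose (p + a + 1) from
      congrArg₂ Nat.choose (by omega) (by omega)]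
  apply Nat.cast_injective (R := ℚ)
  push_cast
  simp only [Nat.cast_add_choose ℚ]
  simp only [show p + b + 2 + (a + 1) = p + a + b + 2 + 1 by omega,
    show p + b + 2 + a = p + a + b + 2 by omega, show p + a + 1 + (b + 1) = p + a + b + 2 by omega,
    show p + (b + 1) = p + b + 1 by omega, show p + 1 + b = p + b + 1 by omega,
    show p + 1 + (a + 1) = p + a + 1 + 1 by omega]
  rw [Nat.factorial_succ (p + a + b + 2), Nat.factorial_succ (p + b + 1),
    Nat.factorial_succ (p + a + 1), Nat.factorial_succ p, Nat.factorial_succ a, Nat.factorial_succ b]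
  have hp0 : (p.factorial : ℚ) ≠ 0 := by positivity
  have ha0 : (a.factorial : ℚ) ≠ 0 := by positivity
  have hb0 : (b.factorial : ℚ) ≠ 0 := by positivity
  have hN0 : ((p + a + b + 2).factorial : ℚ) ≠ 0 := by positivity
  have hpb0 : ((p + b + 1).factorial : ℚ) ≠ 0 := by positivity
  have hpa0 : ((p + a + 1).factorial : ℚ) ≠ 0 := by positivity
  push_cast
  field_simp
  ring

/-! ### Bott's formula, row `q = r` -/

/-- `H^r(Z_p(k)) = 0` for `p ≥ r + 2` (no `p`-subsets).
[cite: OkonekSchneiderSpindler1980, Ch. I § 1.1 (3)] -/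
theorem finrank_homology_cech_Zsub_top_of_lt (k : ℤ) {p : ℕ} (hp : r + 1 < p) (a : ℤ) :
    Module.finrank ℂ ((LaurentCech.cech (fun _ : Sub (Fin (r + 1)) p => (p : ℤ)) (Zsub r p)
      k).homology a) = 0 := by
  haveI := ModuleCat.subsingleton_of_isZero (isZero_homology_cech_Zsub_of_card_lt k hp a)
  exact Module.finrank_zero_of_subsingleton

/-- `H^r(Z_{r+1}(k)) = 0`: the free term `Λ^{r+2} = 0` maps onto it.
[cite: OkonekSchneiderSpindler1980, Ch. I § 1.1 (3)] -/
theorem finrank_homology_cech_Zsub_top_succ_self (hr : 1 ≤ r) (k : ℤ) :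
    Module.finrank ℂ ((LaurentCech.cech (fun _ : Sub (Fin (r + 1)) (r + 1) => ((r + 1 : ℕ) : ℤ))
      (Zsub r (r + 1)) k).homology r) = 0 := by
  have h := finrank_homology_cech_Zsub_top_le hr (r + 1) k
  rw [Nat.choose_succ_self, zero_mul] at h
  omega

/-- `H^a(Z_{r+1}(k))` is a zero object in the top degree `a = r`.
[cite: OkonekSchneiderSpindler1980, Ch. I § 1.1 (3)] -/
theorem isZero_homology_cech_Zsub_top_succ_self (hr : 1 ≤ r) (k : ℤ) :
    IsZero ((LaurentCech.cech (fun _ : Sub (Fin (r + 1)) (r + 1) => ((r + 1 : ℕ) : ℤ))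
      (Zsub r (r + 1)) k).homology r) := by
  haveI := moduleFinite_homology_cech_Zsub (r := r) k (r + 1) (r : ℤ)
  haveI := Module.finrank_zero_iff.1 (finrank_homology_cech_Zsub_top_succ_self hr k)
  exact ModuleCat.isZero_of_subsingleton _

/-- The induction of the row `q = r` for negative twists `k = -k'`, `k' ≥ 1`, over `1 ≤ p ≤ r`,
parametrised by `n = r - p`. [cite: OkonekSchneiderSpindler1980, Ch. I § 1.1, Bott formula (p. 8)] -/
private theorem finrank_homology_cech_Zsub_top_aux {k' : ℕ} (hk' : 1 ≤ k') :
    ∀ n : ℕ, ∀ {r : ℕ}, 1 ≤ r → ∀ p : ℕ, p + n = r → 1 ≤ p →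
      Module.finrank ℂ ((LaurentCech.cech (fun _ : Sub (Fin (r + 1)) p => (p : ℤ)) (Zsub r p)
        (-(k' : ℤ))).homology r) = (k' + p).choose k' * (k' - 1).choose (r - p) := by
  intro n
  induction n with
  | zero =>
    intro r hr p hp _
    obtain rfl : p = r := by omega
    -- `p = r`: `H^r(Z_{r+1}) = 0`, so `dim H^r(Z_r(-k')) = C(r+1, r+1)·C(r+k', r)`
    have hadd := finrank_homology_cech_Zsub_top_add_of_mono hr p (-(k' : ℤ))
      (mono_homologyMap_ses_f_of_isZero p _ (Or.inr (isZero_homology_cech_Zsub_top_succ_self hr _)))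
    rw [finrank_homology_cech_Zsub_top_succ_self hr, add_zero, Nat.choose_self, one_mul,
      show ((p : ℤ) - -(k' : ℤ)).toNat = k' + p by omega] at hadd
    rw [hadd, Nat.sub_self, Nat.choose_zero_right, mul_one]
    exact Nat.choose_symm_add.symm
  | succ n ih =>
    intro r hr p hp hp1
    obtain rfl : r = p + n + 1 := by omega
    rcases le_or_gt (n + 1) k' with hkn | hkn
    · -- `k' ≥ r - p`: the exact sequence and the identity with `a = p + 1`, `b = k' - n - 1`
      obtain ⟨b, rfl⟩ : ∃ b, k' = n + b + 1 := ⟨k' - n - 1, by omega⟩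
      have ihp := ih hr (p + 1) (by omega) (by omega)
      have hmono := mono_homologyMap_ses_f_of_isZero (r := p + n + 1) p (-((n + b + 1 : ℕ) : ℤ))
        (Or.inl (isZero_homology_cech_Zsub_of_pos_of_lt (r := p + n + 1) (by omega) p _
          (a := (p + n + 1 : ℕ) - 1) (by omega) (by omega) (by omega)))
      have hadd := finrank_homology_cech_Zsub_top_add_of_mono hr p _ hmono
      have e1 : (p + n + 1 + 1).choose (p + 1) = (n + (p + 1) + 1).choose (n + 1) := by
        rw [show p + n + 1 + 1 = (n + 1) + (p + 1) by omega, ← Nat.choose_symm_add]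
        exact congrArg₂ Nat.choose (by omega) rfl
      rw [ihp, show ((p : ℤ) - -((n + b + 1 : ℕ) : ℤ)).toNat = n + (p + 1) + b by omega,
        show p + n + 1 - (p + 1) = n by omega, e1,
        show (n + b + 1 + (p + 1)).choose (n + b + 1) = (n + (p + 1) + b + 1).choose (n + b + 1) from
          congrArg₂ Nat.choose (by omega) rfl,
        show (n + b + 1 - 1).choose n = (n + b).choose n from congrArg₂ Nat.choose (by omega) rfl,
        show (n + (p + 1) + b).choose (p + n + 1) = (n + (p + 1) + b).choose (n + (p + 1)) from
          congrArg₂ Nat.choose rfl (by omega)] at hadd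
      rw [show (n + b + 1 + p).choose (n + b + 1) = (n + (p + 1) + b).choose (n + b + 1) from
          congrArg₂ Nat.choose (by omega) rfl,
        show (n + b + 1 - 1).choose (p + n + 1 - p) = (n + b).choose (n + 1) from
          congrArg₂ Nat.choose (by omega) (by omega)]
      have hid := choose_mul_choose_add_choose_mul_choose n (p + 1) b
      omega
    · -- `k' < r - p`: no negative monomials in the free term, `C(p + k', r) = 0`
      have hle := finrank_homology_cech_Zsub_top_le hr p (-(k' : ℤ))
      rw [show ((p : ℤ) - -(k' : ℤ)).toNat = p + k' by omega,
        Nat.choose_eq_zero_of_lt (by omega : p + k' < p + n + 1), mul_zero] at hle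
      rw [Nat.choose_eq_zero_of_lt (by omega : k' - 1 < p + n + 1 - p), mul_zero]
      omega

/-- **Bott's formula, row `q = r`, `p = 0`: `h^r(ℙ_r, 𝒪(-k')) = C(k'-1, r)`** in the `Z_0 = P`
format (`Zsub_zero`; `LaurentCech.finrank_homology_cech_twist_top`).
[cite: OkonekSchneiderSpindler1980, Ch. I § 1.1, Bott formula (p. 8)] -/
theorem finrank_homology_cech_Zsub_zero_top (hr : 1 ≤ r) (k : ℤ) :
    Module.finrank ℂ ((LaurentCech.cech (fun _ : Sub (Fin (r + 1)) 0 => ((0 : ℕ) : ℤ)) (Zsub r 0)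
      k).homology r) = ((-k - 1).toNat).choose r := by
  letI : Unique (Sub (Fin (r + 1)) 0) :=
    ⟨⟨⟨∅, Finset.card_empty⟩⟩, fun I => Subtype.ext (Finset.card_eq_zero.mp I.2)⟩
  rw [Zsub_zero, LaurentCech.finrank_homology_cech_top_top _ k hr, Fintype.sum_unique]
  simp

/-- **Bott's formula, row `q = r` (algebraic side): for `r ≥ 1`, `0 ≤ p ≤ r` and every `k' ≥ 1`,
`dim_ℂ H^r(ℙ_r, Ω^p(-k')) = dim_ℂ H^r(Č_{-k'}(Z_p)) = C(k'+p, k')·C(k'-1, r-p)`** — OSS p. 8,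
"`h^q(ℙ_n, Ω^p(k)) = C(-k+p, -k)·C(-k-1, n-p)` for `q = n`, `0 ≤ p ≤ n`, `k < p - n`" (`k = -k'`);
for `p - n ≤ k ≤ -1` both sides are `0` ("otherwise"). Directly from the exact sequences (3) at the
top degree (no Serre duality). [cite: OkonekSchneiderSpindler1980, Ch. I § 1.1, Bott formula (p. 8)] -/
theorem finrank_homology_cech_Zsub_top (hr : 1 ≤ r) {p : ℕ} (hp : p ≤ r) {k' : ℕ} (hk' : 1 ≤ k') :
    Module.finrank ℂ ((LaurentCech.cech (fun _ : Sub (Fin (r + 1)) p => (p : ℤ)) (Zsub r p)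
      (-(k' : ℤ))).homology r) = (k' + p).choose k' * (k' - 1).choose (r - p) := by
  rcases Nat.eq_zero_or_pos p with rfl | hp1
  · rw [finrank_homology_cech_Zsub_zero_top hr, add_zero, Nat.choose_self, one_mul, Nat.sub_zero]
    congr 1
    omega
  · obtain ⟨n, hn⟩ : ∃ n, p + n = r := ⟨r - p, by omega⟩
    exact finrank_homology_cech_Zsub_top_aux hk' n hr p hn hp1

/-- **Bott's formula, row `q = r`, twists `k ≥ 0`: `H^r(ℙ_r, Ω^p(k)) = 0` for `k ≥ 0`,
`(p, k) ≠ (r, 0)`** (`r ≥ 1`; algebraic side, as a dimension): the free term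
`H^r(Λ^{p+1}𝒪^{r+1}(k-p-1))` already vanishes. [cite: OkonekSchneiderSpindler1980, Ch. I § 1.1, Bott formula (p. 8)] -/
theorem finrank_homology_cech_Zsub_top_of_nonneg (hr : 1 ≤ r) (p : ℕ) {k : ℤ} (hk : 0 ≤ k)
    (hpk : ¬(p = r ∧ k = 0)) :
    Module.finrank ℂ ((LaurentCech.cech (fun _ : Sub (Fin (r + 1)) p => (p : ℤ)) (Zsub r p)
      k).homology r) = 0 := by
  rcases Nat.lt_or_ge (r + 1) p with hp | hp
  · exact finrank_homology_cech_Zsub_top_of_lt k hp r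
  · rcases hp.eq_or_lt with rfl | hp
    · exact finrank_homology_cech_Zsub_top_succ_self hr k
    · have hle := finrank_homology_cech_Zsub_top_le hr p k
      rw [Nat.choose_eq_zero_of_lt (by omega : ((p : ℤ) - k).toNat < r), mul_zero] at hle
      omega

/-- **The complete row `q = r` of Bott's table (algebraic side)**, `r ≥ 1`, all `p`, all `k ∈ ℤ`:
`dim_ℂ H^r(ℙ_r, Ω^p(k))` is `C(-k+p, -k)·C(-k-1, r-p)` for `p ≤ r`, `k ≤ -1`; `1` for
`(p, k) = (r, 0)` (`ProjectiveSpaceHodgeNumbers`); `0` otherwise.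
[cite: OkonekSchneiderSpindler1980, Ch. I § 1.1, Bott formula (p. 8)] -/
theorem finrank_homology_cech_Zsub_top_eq (hr : 1 ≤ r) (p : ℕ) (k : ℤ) :
    Module.finrank ℂ ((LaurentCech.cech (fun _ : Sub (Fin (r + 1)) p => (p : ℤ)) (Zsub r p)
      k).homology r) =
      if p ≤ r ∧ k < 0 then ((-k).toNat + p).choose (-k).toNat * ((-k).toNat - 1).choose (r - p)
      else if p = r ∧ k = 0 then 1 else 0 := by
  split_ifs with h1 h2
  · obtain ⟨k', hk'⟩ : ∃ k' : ℕ, k = -(k' : ℤ) := ⟨(-k).toNat, by omega⟩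
    subst hk'
    rw [show (-(-(k' : ℤ))).toNat = k' by omega]
    exact finrank_homology_cech_Zsub_top hr h1.1 (by omega)
  · obtain ⟨rfl, rfl⟩ := h2
    exact finrank_homology_cech_Zsub_twist_zero hr le_rfl
  · rcases Nat.lt_or_ge (r + 1) p with hp | hp
    · exact finrank_homology_cech_Zsub_top_of_lt k hp r
    · rcases Nat.lt_or_ge r p with hp' | hp'
      · obtain rfl : p = r + 1 := by omega
        exact finrank_homology_cech_Zsub_top_succ_self hr k
      · exact finrank_homology_cech_Zsub_top_of_nonneg hr p (k := k) (by omega) h2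

/-! ### The holomorphic side, by GAGA -/

/-- **Bott's formula, row `q = r`, holomorphic Čech form: `dim_ℂ Ȟ^r(𝔘^h, Ω^p(-k')^h) =
C(k'+p, k')·C(k'-1, r-p)` on `ℙ_r(ℂ)`** (`r ≥ 1`, `p ≤ r`, `k' ≥ 1`), transported along Serre's
GAGA isomorphism (`isIso_homologyMap_cechComparison`).
[cite: OkonekSchneiderSpindler1980, Ch. I § 1.1, Bott formula (p. 8)]
[cite: SerreGAGA1956, n° 12 Théorème 1] -/
theorem finrank_homology_holCech_top (hr : 1 ≤ r) {p : ℕ} (hp : p ≤ r) {k' : ℕ} (hk' : 1 ≤ k') :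
    Module.finrank ℂ ((holCech r p (-(k' : ℤ))).homology r) =
      (k' + p).choose k' * (k' - 1).choose (r - p) := by
  haveI := isIso_homologyMap_cechComparison (r := r) p (-(k' : ℤ)) r
  rw [← (asIso (HomologicalComplex.homologyMap (cechComparison r p (-(k' : ℤ))) r)).toLinearEquiv.finrank_eq]
  exact finrank_homology_cech_Zsub_top hr hp hk'

/-- **The complete row `q = r` of Bott's table, holomorphic Čech form** on `ℙ_r(ℂ)`, `r ≥ 1`.
[cite: OkonekSchneiderSpindler1980, Ch. I § 1.1, Bott formula (p. 8)]
[cite: SerreGAGA1956, n° 12 Théorème 1] -/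
theorem finrank_homology_holCech_top_eq (hr : 1 ≤ r) (p : ℕ) (k : ℤ) :
    Module.finrank ℂ ((holCech r p k).homology r) =
      if p ≤ r ∧ k < 0 then ((-k).toNat + p).choose (-k).toNat * ((-k).toNat - 1).choose (r - p)
      else if p = r ∧ k = 0 then 1 else 0 := by
  haveI := isIso_homologyMap_cechComparison (r := r) p k r
  rw [← (asIso (HomologicalComplex.homologyMap (cechComparison r p k) r)).toLinearEquiv.finrank_eq]
  exact finrank_homology_cech_Zsub_top_eq hr p k

end GAGAForms

end Literature.AlgebraicGeometry.HodgeTheory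

end
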